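import Mathlib
import Literature.NumberTheory.Transcendental.DeRhamTheoremCechProofs
import Literature.NumberTheory.Transcendental.DeRhamTheoremProofs
import Literature.AlgebraicGeometry.HodgeTheory.ComplexifiedDeRhamFamily
import Literature.AlgebraicGeometry.HodgeTheory.HodgeFiltration
import Literature.Geometry.Kaehler.HolomorphicLineBundle
import Literature.Geometry.Kaehler.ManifoldFormsChart
import Literature.Geometry.Kaehler.LocalForms
import Literature.Geometry.Manifold.IntegrationClassSmallCochains
import Literature.Geometry.Manifold.CechSmoothSingularStaircase
import HarnessLib

/-!
# LefschetzOneOneCechIntegrality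

Topic `Literature/AlgebraicGeometry/HodgeTheory`. Named literature fact(s) relocated by the gate from `Summits/HodgeConjecture/HodgeConjecture/Theorems/NikulinTwinTransportLefschetzOneOneK3CechIntegrality.lean`
(accept-time relocation of `[cite]`d propositions written inline in a Summits proposal; human ruling 2026-08-15).
Sources: BottTu1982Forms.

* `Literature.AlgebraicGeometry.HodgeTheory.CechCocycleIntegral`

## Discharge (appended)

`CechCocycleIntegral_holds : CechCocycleIntegral` — the fact is PROVED below, on the smooth
Čech–singular double complex of the cover (`Geometry/Manifold/CechSmoothSingular*`,
`IntegrationClassSmallCochains`): the integral cocycle `ζ` representing the integration class of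
`Re θ` (resp. `Im θ`, with zero values) and the integration cochain `∫ Re θ` define the same class
of smooth `𝔘`-small cochains (`exists_singSmall_sub_intSmall_eq_dA`); the Čech comparison
isomorphism sends `[∫ Re θ]` to the class of the constant cocycle `(Re c_ijk)`
(`cechSmoothSingularEquiv_intSmall_eq`, the de Rham zigzag) and `[ζ]` to the class of an
INTEGER-valued Čech cocycle (`exists_cechZeroSCocycles_of_isValuedIn`, the integral staircase);
their difference is a Čech coboundary of smooth `0`-cocycles, constant on the chart-convex double
intersections, and evaluation at a point of `U_i ∩ U_j ∩ U_k` gives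
`Re c_ijk − (a_ij + a_jk − a_ik) ∈ ℤ`, `Im c_ijk − (a'_ij + a'_jk − a'_ik) = 0`
(`exists_sub_cechδ_mem_of_integration_eq_π`, the real core for any subgroup `Γ ⊆ ℝ` of values).
Weil (1952), §3; Bott–Tu (1982), Thm. 8.9, Prop. 9.5, Thm. 15.8.
-/

namespace Literature.AlgebraicGeometry.HodgeTheory

open scoped Manifold ContDiff Topology
open Set
open Literature.Geometry.Kaehler
open Literature.NumberTheory.Transcendental
open Literature.AlgebraicGeometry
open Literature.AlgebraicGeometry.HodgeTheory
open Literature.AlgebraicTopology.SingularHomology (singularCohomology)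

/-- **Integral classes have integral Čech cocycles (degree `2`, chart-convex covers).** Let `M`
be a compact Hausdorff real-`C^∞` manifold charted on the finite-dimensional complex normed space
`E`, `𝒰 = (U_i)_{i ∈ ι}` a finite chart-convex cover of `M` (all nonempty finite intersections are
chart sets of open convex sets: a finite good cover), and `ω` a closed smooth complex `2`-form
whose class is INTEGRAL under de Rham's integration comparison
`(integrationDeRhamIsoFamily E) ⊗ ℂ : H²_dR(M; ℂ) ≃ H²(M; ℂ)`. Then for every Čech–de Rham zigzag
of `ω` on `𝒰` — `1`-forms `α_i` on `U_i` with `dα_i = ω`, functions `f_ij` on `U_i ∩ U_j` with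
`df_ij = α_i − α_j`, constants `c_ijk = f_ij + f_jk − f_ik` on the nonempty `U_i ∩ U_j ∩ U_k` —
the (ordered) Čech `2`-cocycle `c` is cohomologous to an integer cocycle: `c_ijk − (a_ij + a_jk −
a_ik) ∈ ℤ` for some constants `a_ij`. (The zigzag represents the image of `[ω]` under the
Čech–de Rham isomorphism of the acyclic cover, Bott–Tu Thm. 8.9 / Prop. 9.5; the Čech–singular
isomorphism of the same cover holds with coefficients `ℤ` and `ℂ` compatibly, Thm. 15.8; and the
composite is de Rham's integration isomorphism, §15 / Weil 1952 §§3–4, under which integral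
singular classes correspond to integral Čech classes.)
[cite: BottTu1982Forms, Thm. 8.9, Prop. 9.5, Thm. 15.8] [file AlgebraicGeometry/HodgeTheory/LefschetzOneOneCechIntegrality] -/
def CechCocycleIntegral : Prop :=
  ∀ (E : Type) [NormedAddCommGroup E] [NormedSpace ℂ E] [FiniteDimensional ℝ E]
    (M : Type) [TopologicalSpace M] [ChartedSpace E M]
    [IsManifold (modelWithCornersSelf ℝ E) ((⊤ : ℕ∞) : WithTop ℕ∞) M] [T2Space M]
    [CompactSpace M] (ι : Type) [Fintype ι]
    (𝒰 : Literature.NumberTheory.Transcendental.ChartConvexCover E M ι)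
    (θ : Literature.Geometry.Kaehler.MForm (modelWithCornersSelf ℝ E) M ℂ 2)
    (hθ : θ ∈ Literature.NumberTheory.Transcendental.cclosedSmoothForms E M 2),
    Literature.AlgebraicGeometry.HodgeTheory.IsIntegralClass
      ((Literature.NumberTheory.Transcendental.DeRhamIsoFamily.complexify
        (Literature.NumberTheory.Transcendental.integrationDeRhamIsoFamily E)) M 2
        (Literature.NumberTheory.Transcendental.complexDeRhamCohomology.mk E M 2 ⟨θ, hθ⟩)) →
    ∀ (α : ι → Literature.Geometry.Kaehler.MForm (modelWithCornersSelf ℝ E) M ℂ 1),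
      (∀ i, α i ∈ Literature.Geometry.Kaehler.smoothFormsOn (modelWithCornersSelf ℝ E) ℂ (𝒰.U i) 1) →
      (∀ i, ∀ x ∈ 𝒰.U i, Literature.Geometry.Kaehler.mextDeriv (α i) x = θ x) →
    ∀ (f : ι → ι → M → ℂ),
      (∀ i j, ∀ x ∈ 𝒰.U i ∩ 𝒰.U j,
        (Literature.Geometry.Kaehler.MForm.ofFun (modelWithCornersSelf ℝ E) (f i j)).SmoothAt x) →
      (∀ i j, ∀ x ∈ 𝒰.U i ∩ 𝒰.U j,
        Literature.Geometry.Kaehler.mextDeriv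
          (Literature.Geometry.Kaehler.MForm.ofFun (modelWithCornersSelf ℝ E) (f i j)) x = α i x - α j x) →
    ∀ (c : ι → ι → ι → ℂ),
      (∀ i j k, ∀ x ∈ 𝒰.U i ∩ 𝒰.U j ∩ 𝒰.U k, f i j x + f j k x - f i k x = c i j k) →
    ∃ (a : ι → ι → ℂ) (n : ι → ι → ι → ℤ), ∀ i j k, (𝒰.U i ∩ 𝒰.U j ∩ 𝒰.U k).Nonempty →
      c i j k - (a i j + a j k - a i k) = n i j k

/-! ### The three consequences, against the name -/

/-! ## Discharge of `CechCocycleIntegral` -/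

section Discharge

-- see "Implementation notes" in `…SingularHomology.SingularChainsConcrete`
set_option backward.isDefEq.respectTransparency false

open Filter Function
open Literature.Geometry.Manifold
open Literature.Algebra.Homology
open Literature.AlgebraicTopology.SingularHomology hiding cechSet mem_cechSet_iff cechSet_subset_comp
  cechSet_subset_apply cechSet_cons

universe u

noncomputable section

/-! ### Real and imaginary parts of complex forms, pointwise -/

section ReIm

variable {E : Type*} [NormedAddCommGroup E] [NormedSpace ℂ E]
  {M : Type*} [TopologicalSpace M] [ChartedSpace E M] {k : ℕ}

/-- The real part of a form smooth at `x` is smooth at `x`. [cite: Wells1980, Ch. I §3] -/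
theorem smoothAt_re {α : MForm 𝓘(ℝ, E) M ℂ k} {x : M} (h : α.SmoothAt x) : α.re.SmoothAt x := by
  rw [MForm.SmoothAt, MForm.inChart_re]
  exact ((ContinuousLinearMap.compContinuousAlternatingMapCLM ℝ E ℂ ℝ (Fin k)
    Complex.reCLM).contDiff.of_le le_top).comp_contDiffWithinAt h

/-- The imaginary part of a form smooth at `x` is smooth at `x`. [cite: Wells1980, Ch. I §3] -/
theorem smoothAt_im {α : MForm 𝓘(ℝ, E) M ℂ k} {x : M} (h : α.SmoothAt x) : α.im.SmoothAt x := by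
  rw [MForm.SmoothAt, MForm.inChart_im]
  exact ((ContinuousLinearMap.compContinuousAlternatingMapCLM ℝ E ℂ ℝ (Fin k)
    Complex.imCLM).contDiff.of_le le_top).comp_contDiffWithinAt h

/-- **`Re (dα) = d (Re α)` at a point where `α` is smooth** (pointwise form of
`MForm.re_mextDeriv_holds`). [cite: Wells1980, Ch. II §1] -/
theorem re_mextDeriv_apply_of_smoothAt {α : MForm 𝓘(ℝ, E) M ℂ k} {x : M} (hα : α.SmoothAt x) :
    (mextDeriv α).re x = mextDeriv α.re x := by
  have hU : UniqueDiffWithinAt ℝ (range 𝓘(ℝ, E)) (extChartAt 𝓘(ℝ, E) x x) :=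
    (𝓘(ℝ, E)).uniqueDiffOn _ (extChartAt_target_subset_range x (mem_extChartAt_target x))
  have hd : DifferentiableWithinAt ℝ (α.inChart x) (range 𝓘(ℝ, E)) (extChartAt 𝓘(ℝ, E) x x) :=
    hα.differentiableWithinAt (by simp)
  symm
  change (extDerivWithin (α.re.inChart x) (range 𝓘(ℝ, E))
    (extChartAt 𝓘(ℝ, E) x x)).compContinuousLinearMap _ = _
  rw [MForm.inChart_re, extDerivWithin_continuousLinearMap_comp_of_differentiableWithinAt Complex.reCLM _ hd hU]
  rfl

/-- **`Im (dα) = d (Im α)` at a point where `α` is smooth.** [cite: Wells1980, Ch. II §1] -/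
theorem im_mextDeriv_apply_of_smoothAt {α : MForm 𝓘(ℝ, E) M ℂ k} {x : M} (hα : α.SmoothAt x) :
    (mextDeriv α).im x = mextDeriv α.im x := by
  have hU : UniqueDiffWithinAt ℝ (range 𝓘(ℝ, E)) (extChartAt 𝓘(ℝ, E) x x) :=
    (𝓘(ℝ, E)).uniqueDiffOn _ (extChartAt_target_subset_range x (mem_extChartAt_target x))
  have hd : DifferentiableWithinAt ℝ (α.inChart x) (range 𝓘(ℝ, E)) (extChartAt 𝓘(ℝ, E) x x) :=
    hα.differentiableWithinAt (by simp)
  symm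
  change (extDerivWithin (α.im.inChart x) (range 𝓘(ℝ, E))
    (extChartAt 𝓘(ℝ, E) x x)).compContinuousLinearMap _ = _
  rw [MForm.inChart_im, extDerivWithin_continuousLinearMap_comp_of_differentiableWithinAt Complex.imCLM _ hd hU]
  rfl

/-- Real part of a function as a `0`-form. [folklore] -/
theorem ofFun_re (g : M → ℂ) : (MForm.ofFun 𝓘(ℝ, E) g).re = MForm.ofFun 𝓘(ℝ, E) fun x ↦ (g x).re := by
  funext x; ext v; rfl

/-- Imaginary part of a function as a `0`-form. [folklore] -/
theorem ofFun_im (g : M → ℂ) : (MForm.ofFun 𝓘(ℝ, E) g).im = MForm.ofFun 𝓘(ℝ, E) fun x ↦ (g x).im := by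
  funext x; ext v; rfl

end ReIm

/-! ### Čech sets: membership, constant simplices -/

section CechSets

variable {M : Type*} {ι : Type*}

/-- Membership in a double intersection as a Čech set. [folklore] -/
theorem mem_cechSet_vec_two {U : ι → Set M} {i j : ι} {x : M} :
    x ∈ Literature.AlgebraicTopology.SingularHomology.cechSet U ![i, j] ↔ x ∈ U i ∧ x ∈ U j := by
  simp [Literature.AlgebraicTopology.SingularHomology.mem_cechSet_iff, Fin.forall_fin_two]

/-- Membership in a triple intersection as a Čech set. [folklore] -/
theorem mem_cechSet_vec_three {U : ι → Set M} {i j k : ι} {x : M} :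
    x ∈ Literature.AlgebraicTopology.SingularHomology.cechSet U ![i, j, k] ↔ x ∈ U i ∧ x ∈ U j ∧ x ∈ U k := by
  simp only [Literature.AlgebraicTopology.SingularHomology.mem_cechSet_iff, Fin.forall_fin_succ, IsEmpty.forall_iff,
    and_true]
  simp

end CechSets

section ConstAt

variable {E : Type u} [NormedAddCommGroup E] [NormedSpace ℝ E] {M : Type u} [TopologicalSpace M] [ChartedSpace E M]
  {ι : Type*}

/-- The constant `0`-simplex at a point of `U_J` is a smooth `0`-simplex of `U_J`. [folklore] -/
theorem isSmoothIn_constAt_of_mem {U : ι → Set M} {n : ℕ} {J : Fin n → ι} {x : M}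
    (hx : x ∈ Literature.AlgebraicTopology.SingularHomology.cechSet U J) :
    IsSmoothIn 𝓘(ℝ, E) (Literature.AlgebraicTopology.SingularHomology.cechSet U J) (SingularSimplex.constAt x 0) := by
  refine ⟨isSmooth_constAt x 0, ?_⟩
  rw [SingularSimplex.range_constAt, Set.singleton_subset_iff]
  exact hx

end ConstAt

/-! ### The real core: values in a subgroup `Γ ⊆ ℝ` -/

section Core

variable {E : Type u} [NormedAddCommGroup E] [NormedSpace ℝ E] [FiniteDimensional ℝ E]
  {M : Type u} [TopologicalSpace M] [ChartedSpace E M] [IsManifold 𝓘(ℝ, E) ∞ M] [T2Space M] [CompactSpace M]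
  {ι : Type*}

omit [FiniteDimensional ℝ E] [IsManifold 𝓘(ℝ, E) ∞ M] [T2Space M] [CompactSpace M] in
/-- The finite intersections of a chart-convex cover are empty or chart sets of convex subsets of
chart targets (the hypothesis `hW` of the staircase). [folklore] -/
theorem isEmptyOrChartSet_cechSet (𝒰 : ChartConvexCover E M ι) {m : ℕ} (J : Fin (m + 1) → ι) :
    Literature.AlgebraicTopology.SingularHomology.cechSet 𝒰.U J = ∅ ∨
      ∃ (p : M) (C : Set E), Convex ℝ C ∧ C ⊆ (extChartAt 𝓘(ℝ, E) p).target ∧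
        Literature.AlgebraicTopology.SingularHomology.cechSet 𝒰.U J = chartSet 𝓘(ℝ, E) p C := by
  rcases (Literature.AlgebraicTopology.SingularHomology.cechSet 𝒰.U J).eq_empty_or_nonempty with h | h
  · exact Or.inl h
  · obtain ⟨p, C, -, hCc, hCt, hJ⟩ := 𝒰.exists_chart m J h
    refine Or.inr ⟨p, C, hCc, ?_, hJ⟩
    rw [extChartAt_self]
    exact hCt

/-- **The real core of the Čech integrality step.** Let `𝒰` be a chart-convex finite cover of the
compact manifold `M`, `Γ ⊆ ℝ` a subgroup, `η` a closed smooth real `2`-form whose integration class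
(de Rham's theorem by integration) is the class of a singular cocycle `ζ` WITH VALUES IN `Γ`, and
`(α_i, f_ij, c_ijk)` a zigzag resolving `η` on `𝒰`. Then, after adjustment by a Čech coboundary of
constants, the `c_ijk` lie in `Γ`: `c_ijk − (a_ij + a_jk − a_ik) ∈ Γ` on the nonempty triple
intersections. [cite: BottTu1982Forms, Thm. 15.8 with Prop. 9.5] -/
theorem exists_sub_cechδ_mem_of_integration_eq_π (𝒰 : ChartConvexCover E M ι) (Γ : AddSubgroup ℝ)
    {η : MForm 𝓘(ℝ, E) M ℝ 2} (hη : η ∈ closedSmoothForms 𝓘(ℝ, E) M ℝ 2)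
    (ζ : singularCochainComplex.cocycles ℝ ℝ M 2)
    (hζ : integrationDeRhamIsoFamily E M 2 (deRhamCohomology.mk ⟨η, hη⟩) = singularCohomology.π ℝ ℝ M 2 ζ)
    (hv : ∀ σ, singularCochainComplex.iCocycles ℝ ℝ M 2 ζ σ ∈ Γ)
    {α : ι → MForm 𝓘(ℝ, E) M ℝ 1} (hα : ∀ i, ∀ x ∈ 𝒰.U i, (α i).SmoothAt x)
    (hdα : ∀ i, ∀ x ∈ 𝒰.U i, mextDeriv (α i) x = η x)
    {f : ι → ι → M → ℝ} (hfs : ∀ i j, ∀ x ∈ 𝒰.U i ∩ 𝒰.U j, (MForm.ofFun 𝓘(ℝ, E) (f i j)).SmoothAt x)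
    (hdf : ∀ i j, ∀ x ∈ 𝒰.U i ∩ 𝒰.U j, mextDeriv (MForm.ofFun 𝓘(ℝ, E) (f i j)) x = α i x - α j x)
    {c : ι → ι → ι → ℝ} (hc : ∀ i j k, ∀ x ∈ 𝒰.U i ∩ 𝒰.U j ∩ 𝒰.U k, f i j x + f j k x - f i k x = c i j k) :
    ∃ a : ι → ι → ℝ, ∀ i j k, (𝒰.U i ∩ 𝒰.U j ∩ 𝒰.U k).Nonempty → c i j k - (a i j + a j k - a i k) ∈ Γ := by
  classical
  set U := 𝒰.U with hUdef
  have hU : ∀ i, IsOpen (U i) := 𝒰.isOpen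
  have hW : ∀ {m : ℕ} (J : Fin (m + 1) → ι), Literature.AlgebraicTopology.SingularHomology.cechSet U J = ∅ ∨
      ∃ (p : M) (C : Set E), Convex ℝ C ∧ C ⊆ (extChartAt 𝓘(ℝ, E) p).target ∧
        Literature.AlgebraicTopology.SingularHomology.cechSet U J = chartSet 𝓘(ℝ, E) p C :=
    fun J ↦ isEmptyOrChartSet_cechSet 𝒰 J
  have hs : IsSmoothForm η := ((mem_closedSmoothForms_iff η).1 hη).1
  have hcl : IsClosedForm η := ((mem_closedSmoothForms_iff η).1 hη).2
  -- the two cocycles of smooth small cochains and their common class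
  set Zsm := singSmall 𝓘(ℝ, E) U 2 (singularCochainComplex.iCocycles ℝ ℝ M 2 ζ) with hZsm
  have hZc : Zsm ∈ NatCochain.cocycles (cechSmoothSingularRow 𝓘(ℝ, E) ℝ ℝ U).dA 2 :=
    singSmall_mem_cocycles U 2 _ (singularCochainComplex.d_iCocycles 3 ζ)
  have hAc := intSmallCochain_mem_cocycles U hs hcl
  obtain ⟨W, hW'⟩ := exists_singSmall_sub_intSmall_eq_dA ⟨η, hη⟩ ζ hζ U
  have hcls : NatCochain.Cohomology.mk (cechSmoothSingularRow 𝓘(ℝ, E) ℝ ℝ U).dA 2 ⟨Zsm, hZc⟩ =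
      NatCochain.Cohomology.mk (cechSmoothSingularRow 𝓘(ℝ, E) ℝ ℝ U).dA 2 ⟨intSmallCochain U 2 η, hAc⟩ := by
    rw [NatCochain.Cohomology.mk_eq_mk_iff, NatCochain.mem_coboundaries_succ_iff]
    exact ⟨W, hW'.symm⟩
  -- the Čech comparison isomorphism on both
  have hacyc := hacyc_of_isEmptyOrChartSet (R := ℝ) (N := ℝ) U hW
  have hint := cechSmoothSingularEquiv_intSmall_eq hU hacyc hs hcl hα hdα hfs hdf hc
  have hvZ : ∀ J : Fin 1 → ι, IsValuedIn Γ ((cechSmoothSingularRow 𝓘(ℝ, E) ℝ ℝ U).ε 2 Zsm J) := by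
    intro J τ hτ
    rw [sEvalSimplex_of_isSmoothIn _ hτ, cechSmoothSingularRow_ε_apply_sElemChain, hZsm, singSmall_apply_single]
    exact hv τ
  obtain ⟨b, hb, hvb, hstair⟩ := exists_cechZeroSCocycles_of_isValuedIn U hW Γ Zsm hZc hvZ
  -- `(c) - b` is a Čech coboundary of smooth `0`-cocycles
  have hcb : NatCochain.Cohomology.mk (cechZeroSδ 𝓘(ℝ, E) ℝ ℝ U) 2
      ⟨cechConstCochain U 𝓘(ℝ, E) hU c, cechConstCochain_mem_cocycles hU hc⟩ =
      NatCochain.Cohomology.mk (cechZeroSδ 𝓘(ℝ, E) ℝ ℝ U) 2 ⟨b, hb⟩ := by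
    rw [← hint, ← hstair, hcls]
  rw [NatCochain.Cohomology.mk_eq_mk_iff, NatCochain.mem_coboundaries_succ_iff] at hcb
  obtain ⟨a', ha'⟩ := hcb
  -- the constants: values of `a'_{ij}` at a point of `U_i ∩ U_j`
  set A2 : (Fin 2 → ι) → ℝ := fun K ↦ if h : (U (K 0) ∩ U (K 1)).Nonempty then
    sEvalSimplex (a' K : SCochainOn 𝓘(ℝ, E) ℝ ℝ (Literature.AlgebraicTopology.SingularHomology.cechSet U K) 0)
      (SingularSimplex.constAt h.some 0) else 0 with hA2
  -- `a'_K` is constant: its value at any point of `U_K` is `A2 K`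
  have hA2val : ∀ (K : Fin 2 → ι) {x : M} (hx : x ∈ U (K 0) ∩ U (K 1)),
      sEvalSimplex (a' K : SCochainOn 𝓘(ℝ, E) ℝ ℝ (Literature.AlgebraicTopology.SingularHomology.cechSet U K) 0)
        (SingularSimplex.constAt x 0) = A2 K := by
    intro K x hx
    have hne : (U (K 0) ∩ U (K 1)).Nonempty := ⟨x, hx⟩
    rw [hA2]
    simp only [dif_pos hne]
    have hK : ∀ {y : M}, y ∈ U (K 0) ∩ U (K 1) → y ∈ Literature.AlgebraicTopology.SingularHomology.cechSet U K :=
      fun {y} hy ↦ Literature.AlgebraicTopology.SingularHomology.mem_cechSet_iff.2 fun m ↦ by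
        fin_cases m
        · exact hy.1
        · exact hy.2
    exact sEvalSimplex_eq_of_mem_zeroSCocycles (hW K) (a' K).2 (isSmoothIn_constAt_of_mem (hK hx))
      (isSmoothIn_constAt_of_mem (hK hne.some_mem))
  refine ⟨fun i j ↦ A2 ![i, j], fun i j k hne ↦ ?_⟩
  change c i j k - (A2 ![i, j] + A2 ![j, k] - A2 ![i, k]) ∈ Γ
  obtain ⟨x, hx⟩ := hne
  have hx3 : x ∈ Literature.AlgebraicTopology.SingularHomology.cechSet U ![i, j, k] :=
    mem_cechSet_vec_three.2 ⟨hx.1.1, hx.1.2, hx.2⟩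
  have hsx := isSmoothIn_constAt_of_mem (E := E) hx3
  -- evaluate `δ a' = (c) - b` at the point `x` of `U_i ∩ U_j ∩ U_k`
  have hev := congrArg (fun y : CechZeroSCocycles 𝓘(ℝ, E) ℝ ℝ U 2 ↦
    sEvalSimplex (y ![i, j, k] : SCochainOn 𝓘(ℝ, E) ℝ ℝ (Literature.AlgebraicTopology.SingularHomology.cechSet U ![i, j, k]) 0)
      (SingularSimplex.constAt x 0)) ha'
  simp only at hev
  rw [coe_cechZeroSδ_apply, sEvalSimplex_sum, Fin.sum_univ_three] at hev
  simp only [sEvalSimplex_smul, sEvalSimplex_scres _ _ hsx, Fin.val_zero, Fin.val_one, Fin.val_two, pow_zero,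
    pow_one, neg_one_sq, one_smul, smul_eq_mul, one_mul, neg_mul, Pi.sub_apply,
    Submodule.coe_sub, sEvalSimplex_sub, coe_cechConstCochain, sEvalSimplex_intSCochain_ofFun _ hsx] at hev
  -- the faces of `(i, j, k)`
  have e0 : ((![i, j, k] : Fin 3 → ι) ∘ Fin.succAbove 0) = ![j, k] := by
    funext m; fin_cases m <;> rfl
  have e1 : ((![i, j, k] : Fin 3 → ι) ∘ Fin.succAbove 1) = ![i, k] := by
    funext m; fin_cases m <;> rfl
  have e2 : ((![i, j, k] : Fin 3 → ι) ∘ Fin.succAbove 2) = ![i, j] := by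
    funext m; fin_cases m <;> rfl
  rw [e0, e1, e2, hA2val ![j, k] ⟨hx.1.2, hx.2⟩, hA2val ![i, k] ⟨hx.1.1, hx.2⟩, hA2val ![i, j] ⟨hx.1.1, hx.1.2⟩] at hev
  have hbx := hvb ![i, j, k] _ hsx
  have key : c i j k - (A2 ![i, j] + A2 ![j, k] - A2 ![i, k]) =
      sEvalSimplex (b ![i, j, k] : SCochainOn 𝓘(ℝ, E) ℝ ℝ (Literature.AlgebraicTopology.SingularHomology.cechSet U ![i, j, k]) 0)
        (SingularSimplex.constAt x 0) := by
    simp only [Matrix.cons_val_zero, Matrix.cons_val_one, Matrix.cons_val_two, Matrix.head_cons,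
      Matrix.tail_cons] at hev
    linarith
  rw [key]
  exact hbx

end Core

/-! ### The complex statement -/

section Complex

/-- The values of an integral cocycle have integral real parts. [folklore] -/
theorem re_mem_range_of_mem_range_intCast {w : ℂ} (h : w ∈ Set.range (Int.cast : ℤ → ℂ)) :
    w.re ∈ (Int.castAddHom ℝ).range := by
  obtain ⟨m, rfl⟩ := h
  exact ⟨m, by simp⟩

/-- The values of an integral cocycle have zero imaginary parts. [folklore] -/
theorem im_mem_bot_of_mem_range_intCast {w : ℂ} (h : w ∈ Set.range (Int.cast : ℤ → ℂ)) :
    w.im ∈ (⊥ : AddSubgroup ℝ) := by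
  obtain ⟨m, rfl⟩ := h
  rw [AddSubgroup.mem_bot]
  simp

/-- **The Čech integrality step (Z) of Lefschetz's theorem on `(1,1)`-classes.** On a compact
`C^∞` manifold charted on the complex normed space `E` with a chart-convex finite cover `𝒰`, let `θ`
be a closed smooth complex `2`-form whose class is INTEGRAL under the complexified integration
isomorphism of de Rham's theorem, and `θ = dα_i` on `U_i`, `α_i − α_j = df_ij` on `U_i ∩ U_j`,
`f_ij + f_jk − f_ik = c_ijk` on `U_i ∩ U_j ∩ U_k`. Then there are constants `a_ij ∈ ℂ` and integers
`n_ijk` with `c_ijk − (a_ij + a_jk − a_ik) = n_ijk` whenever `U_i ∩ U_j ∩ U_k ≠ ∅` (real parts: the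
integral staircase; imaginary parts: the zero cocycle). Weil (1952), §3; Bott–Tu (1982), Thm. 8.9,
Prop. 9.5, Thm. 15.8; Voisin (2002), proof of Thm. 11.30 / §11.3.2.
[cite: BottTu1982Forms, Thm. 15.8 with Prop. 9.5] -/
theorem CechCocycleIntegral_holds : CechCocycleIntegral := by
  intro E _ _ _ M _ _ _ _ _ ι _ 𝒰 θ hθ hint α hαs hdα f hfs hdf c hc
  classical
  obtain ⟨z, hz, hzv⟩ := hint
  set e := integrationDeRhamIsoFamily E with he
  -- the integration classes of `Re θ`, `Im θ` are the classes of `re ∘ z`, `im ∘ z`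
  have hζre : e M 2 (deRhamCohomology.mk ⟨θ.re, re_mem_closedSmoothForms hθ⟩) =
      singularCohomology.π ℝ ℝ M 2 (coeffCocycle (R := ℂ) Complex.reAddGroupHom 2 z) := by
    have h : reClass M 2 (e.complexify M 2 (complexDeRhamCohomology.mk E M 2 ⟨θ, hθ⟩)) =
        singularCohomology.π ℝ ℝ M 2 (coeffCocycle (R := ℂ) Complex.reAddGroupHom 2 z) := by
      rw [← hz]
      exact reClass_π z
    rw [complexify_apply, reClass_complexifyFun, complexDeRhamCohomology.re_mk] at h
    exact h
  have hζim : e M 2 (deRhamCohomology.mk ⟨θ.im, im_mem_closedSmoothForms hθ⟩) =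
      singularCohomology.π ℝ ℝ M 2 (coeffCocycle (R := ℂ) Complex.imAddGroupHom 2 z) := by
    have h : imClass M 2 (e.complexify M 2 (complexDeRhamCohomology.mk E M 2 ⟨θ, hθ⟩)) =
        singularCohomology.π ℝ ℝ M 2 (coeffCocycle (R := ℂ) Complex.imAddGroupHom 2 z) := by
      rw [← hz]
      exact imClass_π z
    rw [complexify_apply, imClass_complexifyFun, complexDeRhamCohomology.im_mk] at h
    exact h
  have hvre : ∀ σ, singularCochainComplex.iCocycles ℝ ℝ M 2 (coeffCocycle (R := ℂ) Complex.reAddGroupHom 2 z) σ ∈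
      (Int.castAddHom ℝ).range := fun σ ↦ by
    rw [iCocycles_coeffCocycle, coeffCochain_apply]
    exact re_mem_range_of_mem_range_intCast (hzv σ)
  have hvim : ∀ σ, singularCochainComplex.iCocycles ℝ ℝ M 2 (coeffCocycle (R := ℂ) Complex.imAddGroupHom 2 z) σ ∈
      (⊥ : AddSubgroup ℝ) := fun σ ↦ by
    rw [iCocycles_coeffCocycle, coeffCochain_apply]
    exact im_mem_bot_of_mem_range_intCast (hzv σ)
  -- the real and imaginary zigzags
  have hαre : ∀ i, ∀ x ∈ 𝒰.U i, (α i).re.SmoothAt x := fun i x hx ↦ smoothAt_re ((hαs i).1 x hx)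
  have hαim : ∀ i, ∀ x ∈ 𝒰.U i, (α i).im.SmoothAt x := fun i x hx ↦ smoothAt_im ((hαs i).1 x hx)
  have hdαre : ∀ i, ∀ x ∈ 𝒰.U i, mextDeriv (α i).re x = θ.re x := fun i x hx ↦ by
    rw [← re_mextDeriv_apply_of_smoothAt ((hαs i).1 x hx)]
    change Complex.reCLM.compContinuousAlternatingMap (mextDeriv (α i) x) = _
    rw [hdα i x hx]
    rfl
  have hdαim : ∀ i, ∀ x ∈ 𝒰.U i, mextDeriv (α i).im x = θ.im x := fun i x hx ↦ by
    rw [← im_mextDeriv_apply_of_smoothAt ((hαs i).1 x hx)]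
    change Complex.imCLM.compContinuousAlternatingMap (mextDeriv (α i) x) = _
    rw [hdα i x hx]
    rfl
  have hfsre : ∀ i j, ∀ x ∈ 𝒰.U i ∩ 𝒰.U j, (MForm.ofFun 𝓘(ℝ, E) fun y ↦ (f i j y).re).SmoothAt x :=
    fun i j x hx ↦ by rw [← ofFun_re]; exact smoothAt_re (hfs i j x hx)
  have hfsim : ∀ i j, ∀ x ∈ 𝒰.U i ∩ 𝒰.U j, (MForm.ofFun 𝓘(ℝ, E) fun y ↦ (f i j y).im).SmoothAt x :=
    fun i j x hx ↦ by rw [← ofFun_im]; exact smoothAt_im (hfs i j x hx)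
  have hdfre : ∀ i j, ∀ x ∈ 𝒰.U i ∩ 𝒰.U j,
      mextDeriv (MForm.ofFun 𝓘(ℝ, E) fun y ↦ (f i j y).re) x = (α i).re x - (α j).re x := fun i j x hx ↦ by
    rw [← ofFun_re, ← re_mextDeriv_apply_of_smoothAt (hfs i j x hx)]
    ext v
    simp [MForm.re_apply, hdf i j x hx]
  have hdfim : ∀ i j, ∀ x ∈ 𝒰.U i ∩ 𝒰.U j,
      mextDeriv (MForm.ofFun 𝓘(ℝ, E) fun y ↦ (f i j y).im) x = (α i).im x - (α j).im x := fun i j x hx ↦ by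
    rw [← ofFun_im, ← im_mextDeriv_apply_of_smoothAt (hfs i j x hx)]
    ext v
    simp [MForm.im_apply, hdf i j x hx]
  have hcre : ∀ i j k, ∀ x ∈ 𝒰.U i ∩ 𝒰.U j ∩ 𝒰.U k,
      (f i j x).re + (f j k x).re - (f i k x).re = (c i j k).re := fun i j k x hx ↦ by
    have h := congrArg Complex.re (hc i j k x hx)
    simpa only [Complex.sub_re, Complex.add_re] using h
  have hcim : ∀ i j k, ∀ x ∈ 𝒰.U i ∩ 𝒰.U j ∩ 𝒰.U k,
      (f i j x).im + (f j k x).im - (f i k x).im = (c i j k).im := fun i j k x hx ↦ by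
    have h := congrArg Complex.im (hc i j k x hx)
    simpa only [Complex.sub_im, Complex.add_im] using h
  -- the real core, twice
  obtain ⟨ar, har⟩ := exists_sub_cechδ_mem_of_integration_eq_π 𝒰 (Int.castAddHom ℝ).range
    (re_mem_closedSmoothForms hθ) _ hζre hvre hαre hdαre hfsre hdfre hcre
  obtain ⟨ai, hai⟩ := exists_sub_cechδ_mem_of_integration_eq_π 𝒰 (⊥ : AddSubgroup ℝ)
    (im_mem_closedSmoothForms hθ) _ hζim hvim hαim hdαim hfsim hdfim hcim
  refine ⟨fun i j ↦ (ar i j : ℂ) + (ai i j : ℂ) * Complex.I,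
    fun i j k ↦ if h : (𝒰.U i ∩ 𝒰.U j ∩ 𝒰.U k).Nonempty then
      (AddMonoidHom.mem_range.1 (har i j k h)).choose else 0, fun i j k hne ↦ ?_⟩
  have hn : (((AddMonoidHom.mem_range.1 (har i j k hne)).choose : ℤ) : ℝ) =
      (c i j k).re - (ar i j + ar j k - ar i k) := by
    simpa using (AddMonoidHom.mem_range.1 (har i j k hne)).choose_spec
  have h0 : (c i j k).im - (ai i j + ai j k - ai i k) = 0 := by
    simpa using (AddSubgroup.mem_bot).1 (hai i j k hne)
  beta_reduce
  rw [dif_pos hne]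
  apply Complex.ext
  · simp only [Complex.sub_re, Complex.add_re, Complex.mul_re, Complex.ofReal_re, Complex.ofReal_im,
      Complex.I_re, Complex.I_im, mul_zero, mul_one, sub_zero, add_zero, Complex.intCast_re]
    linarith
  · simp only [Complex.sub_im, Complex.add_im, Complex.mul_im, Complex.ofReal_re, Complex.ofReal_im,
      Complex.I_re, Complex.I_im, mul_zero, mul_one, zero_add, add_zero, Complex.intCast_im]
    linarith

end Complex

end

end Discharge

end Literature.AlgebraicGeometry.HodgeTheory
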